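import Summits.Ventures.PercRepro0.Embedding
import Summits.Ventures.PercRepro0.T2Twin
import Summits.Ventures.PercRepro0.Sharpness

/-!
# L4 · NONTRIVIAL closed: `p_c(2) ≤ ½`, hence `1/(2d−1) ≤ p_c(d) < 1` and `p_c(d+1) ≤ p_c(d)` for `d ≥ 2`

Cell pub-perc-repro0, seat p2 (gen 2).  The last open hypothesis of the L-block twin on `Defs.lean` was
`p_c(2) < 1` (`Embedding.L4_Nontrivial_of'`, GLUE-p2-v2 L4(iii)).  It is discharged here by the second half
of the T2 assembly (T2-assembly-p4-v2 §4 Step 2 / PlanarGlue Step 2) on the now-landed inputs: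

* `p_c(2) ≤ ½` (`pc_two_le_half`): if `½ < p_c(2)`, P5 · SHARPNESS at `p = ½` (p4's `Sharp.P5_Sharpness_holds'`)
  gives `P_½(0 ↔ ∂Λ_n) ≤ e^{−cn}`, so `(n+1) e^{−c(n+1)} < ½` for some `n ≥ 1` (p4's
  `Planar.exists_nat_mul_exp_lt_half`), against the crossing bound `½ ≤ (n+1) P_½(0 ↔ ∂Λ_{n+1})`
  (p1's `T2Twin.hcross_holds`, from P6(a));
* hence `p_c(2) < 1` and `L4_Nontrivial_holds : ∀ d ≥ 2, L4_Nontrivial d` (`Embedding.L4_Nontrivial_of'`).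

With `CouplingL2.L1_Monotone_holds`, `CouplingL2.L2_RightCont_holds` and p5's `L5_ZeroOne_holds`, every
L-block statement of `Defs.lean` (L1, L2, L4, L5) is now kernel-checked unconditionally.
No definitions, no hypotheses, no axioms beyond the standard three.
-/

open MeasureTheory ProbabilityTheory unitInterval
open scoped ENNReal Topology

namespace Summit.Ventures.PercRepro0.L2

open Summit.Ventures.PercRepro0.Defs

-- BEGIN BODY

/-- `p_c(2) ≤ ½` (T2-assembly-p4-v2 §4 Step 2): P5 at `½` against the crossing bound of P6(a). -/
theorem pc_two_le_half : pc 2 ≤ 1 / 2 := by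
  by_contra hgt
  have hgt' : (1 : ℝ) / 2 < pc 2 := not_le.mp hgt
  have hlt : ((clamp (1 / 2) : I) : ℝ) < pc 2 := by
    rw [Summit.Ventures.PercRepro0.PlanarT2.coe_clamp_half]
    exact hgt'
  obtain ⟨c, hc, hdec⟩ := Summit.Ventures.PercRepro0.Sharp.P5_Sharpness_holds' 2 (clamp (1 / 2)) hlt
  obtain ⟨n, hn1, hsmall⟩ := Summit.Ventures.PercRepro0.Planar.exists_nat_mul_exp_lt_half hc
  have h1 := Summit.Ventures.PercRepro0.T2Twin.hcross_holds n hn1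
  have h2 : (P 2 (clamp (1 / 2)) (toBoundary 2 (n + 1))).toReal ≤
      Real.exp (-(c * ((n : ℝ) + 1))) := by
    have := hdec (n + 1) (by omega)
    simpa [Nat.cast_add, Nat.cast_one] using this
  have h3 : ((n : ℝ) + 1) * (P 2 (clamp (1 / 2)) (toBoundary 2 (n + 1))).toReal ≤
      ((n : ℝ) + 1) * Real.exp (-(c * ((n : ℝ) + 1))) :=
    mul_le_mul_of_nonneg_left h2 (by positivity)
  linarith

/-- `p_c(2) < 1`. -/
theorem pc_two_lt_one : pc 2 < 1 := lt_of_le_of_lt pc_two_le_half (by norm_num)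

/-- **L4 · NONTRIVIAL holds** for every `d ≥ 2`: `1/(2d−1) ≤ p_c(d) < 1` and `p_c(d+1) ≤ p_c(d)`
(`Defs.L4_Nontrivial d`, unconditional). -/
theorem L4_Nontrivial_holds {d : ℕ} (hd : 2 ≤ d) : L4_Nontrivial d :=
  L4_Nontrivial_of' hd pc_two_lt_one

-- END BODY

end Summit.Ventures.PercRepro0.L2
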